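import Mathlib
import Summits.NavierStokesRegularity.NavierStokesRegularity.Theorems.EulerZoomLiouvillePowerGaugeEulerLiouvilleSelfSimilarNodalCone
import Literature.Analysis.FluidPDE.SelfSimilarEulerBernoulliLocalMax
import HarnessLib.Audit

/-!
# Rung C1 of the crux `EulerZoomLiouville.PowerGaugeEulerLiouville`: tools for the exit analysis at a
# non-vortical stagnation point — eigen-coordinates, the second-order Bernoulli expansion, first exit times

Route №10 `EulerZoomLiouville` (NavierStokesRegularity), crux E = stmt-NavierStokesRegularity-19832,
tenure rung C1 (exactly self-similar members), registered residue `stub_selfSimilarExtremal`.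
Third file of the NODAL-CONTINUUM line (lineage ns-typeII-p1, gen 7).  For a `C²` stationary
self-similar Euler profile `(U, P)` (CIV 2026 (3.3); `V = γ(y−c) + U`, `Ω = curl U`, Bernoulli function
`ℋ` (3.30)) and a NON-VORTICAL stagnation point `z` (`V(z) = 0`, `Ω(z) = 0`, so `DU(z)` is symmetric and
so is `A = DV(z) = γI + DU(z)`):

* `inner_basis_apply_of_isSymmetric`, `inner_apply_self_eq_sum_eigen` — coordinates in an orthonormal
  eigenbasis `b` of a symmetric operator: `⟪b i, Aζ⟫ = a_i ⟪b i, ζ⟫`, `⟪Aζ, ζ⟫ = Σ a_i ⟪b i, ζ⟫²`;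
* `selfSimilarBernoulli_expansion_of_curl_eq_zero` — **the second-order expansion of `ℋ` at a
  non-vortical node: `Hess ℋ(z) = (2γ−1)·DV(z)`** in the quantitative form
  `ℋ(z + ζ) ≥ ℋ(z) + ½(2γ−1)⟪DV(z)ζ, ζ⟫ − ν|ζ|²` for `|ζ| ≤ δ(ν)`, every `ν > 0`.  Proof: along the
  segment `s ↦ z + sζ` the gradient formula (CIV (3.29), tree `fderiv_selfSimilarBernoulli_apply`)
  reads `Dℋ[ζ] = (2γ−1)⟪V, ζ⟫ + ⟪V, DUζ⟫ − ⟪DU V, ζ⟫`; `V(z+sζ) = sAζ + o(s|ζ|)` (tree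
  `exists_ball_linearisation`) and the commutator term is `o(s|ζ|²)` because `DU(z)` is symmetric and
  `DU` is continuous; integrate (monotonicity of `ℋ(z+sζ) − ½s²q`);
* `exists_firstExit` — the first exit time of a continuous curve from a ball it starts inside and
  eventually leaves: `|Y(t₁) − z| = r`, `|Y(t) − z| ≤ r` on `[0, t₁]`.

Consumer: `…SelfSimilarTopBadNodeHyperbolic` (a hyperbolic top bad node is impossible).

WHAT THIS IS NOT: not NS, not E, not rung C1 — calculus bookkeeping for classical profiles.
References: P. Constantin, M. Ignatova, V. Vicol, arXiv:2602.17570 (2026), §3.4.3 (3.29)–(3.31), §3.5.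
[ConstantinIgnatovaVicol2026Putative]
-/

noncomputable section

-- flat `Theorems/<Route><Decl>…` files of one crux share the namespace of the crux (tree convention)
set_option linter.dupNamespace false

open Set Filter Topology Metric Function InnerProductSpace
open scoped RealInnerProductSpace NNReal

namespace Summit.NavierStokesRegularity.NavierStokesRegularity.Theorems.PowerGaugeEulerLiouville.NodalContinuum

open Literature.Analysis Literature.Analysis.FluidPDE Literature.Analysis.ODE
open Summit.NavierStokesRegularity.NavierStokesRegularity.Theorems.PowerGaugeEulerLiouville.NodalFiniteness

variable {γ C : ℝ} {c : EuclideanSpace ℝ (Fin 3)}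
  {U : EuclideanSpace ℝ (Fin 3) → EuclideanSpace ℝ (Fin 3)} {P : EuclideanSpace ℝ (Fin 3) → ℝ}

/-! ### Coordinates in an orthonormal eigenbasis of a symmetric operator -/

section Eigen

variable {ι : Type*} [Fintype ι]

/-- `⟪b i, Aζ⟫ = a_i ⟪b i, ζ⟫` for a symmetric `A` with `A b_i = a_i b_i`. [folklore] -/
theorem inner_basis_apply_of_isSymmetric
    {A : EuclideanSpace ℝ (Fin 3) →L[ℝ] EuclideanSpace ℝ (Fin 3)}
    (hA : (A : EuclideanSpace ℝ (Fin 3) →ₗ[ℝ] EuclideanSpace ℝ (Fin 3)).IsSymmetric)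
    (b : OrthonormalBasis ι ℝ (EuclideanSpace ℝ (Fin 3))) {a : ι → ℝ} (hb : ∀ i, A (b i) = a i • b i)
    (ζ : EuclideanSpace ℝ (Fin 3)) (i : ι) : ⟪b i, A ζ⟫ = a i * ⟪b i, ζ⟫ := by
  have hsym := hA (b i) ζ
  simp only [ContinuousLinearMap.coe_coe] at hsym
  rw [← hsym, hb, real_inner_smul_left]

/-- `⟪Aζ, ζ⟫ = Σ_i a_i ⟪b i, ζ⟫²` in an orthonormal eigenbasis of a symmetric `A`. [folklore] -/
theorem inner_apply_self_eq_sum_eigen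
    {A : EuclideanSpace ℝ (Fin 3) →L[ℝ] EuclideanSpace ℝ (Fin 3)}
    (hA : (A : EuclideanSpace ℝ (Fin 3) →ₗ[ℝ] EuclideanSpace ℝ (Fin 3)).IsSymmetric)
    (b : OrthonormalBasis ι ℝ (EuclideanSpace ℝ (Fin 3))) {a : ι → ℝ} (hb : ∀ i, A (b i) = a i • b i)
    (ζ : EuclideanSpace ℝ (Fin 3)) : ⟪A ζ, ζ⟫ = ∑ i, a i * ⟪b i, ζ⟫ ^ 2 := by
  rw [← b.sum_inner_mul_inner (A ζ) ζ]
  refine Finset.sum_congr rfl fun i _ => ?_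
  rw [← real_inner_comm (A ζ) (b i), inner_basis_apply_of_isSymmetric hA b hb ζ i]
  ring

/-- Upper bound `⟪Aζ, ζ⟫ ≤ α Σ_{a_i > 0} ⟪b i, ζ⟫² − μ Σ_{a_i ≤ 0… < 0} ⟪b i, ζ⟫²` when `a_i ≤ α` for all
`i` and `a_i ≤ −μ` on the non-positive indices. [folklore] -/
theorem inner_apply_self_le_of_eigen
    {A : EuclideanSpace ℝ (Fin 3) →L[ℝ] EuclideanSpace ℝ (Fin 3)}
    (hA : (A : EuclideanSpace ℝ (Fin 3) →ₗ[ℝ] EuclideanSpace ℝ (Fin 3)).IsSymmetric)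
    (b : OrthonormalBasis ι ℝ (EuclideanSpace ℝ (Fin 3))) {a : ι → ℝ} (hb : ∀ i, A (b i) = a i • b i)
    {α μ : ℝ} (hα : ∀ i, a i ≤ α) (hμ : ∀ i, ¬ 0 < a i → a i ≤ -μ) (ζ : EuclideanSpace ℝ (Fin 3)) :
    ⟪A ζ, ζ⟫ ≤ α * (∑ i ∈ Finset.univ.filter (fun i => 0 < a i), ⟪b i, ζ⟫ ^ 2) -
      μ * (∑ i ∈ Finset.univ.filter (fun i => ¬ 0 < a i), ⟪b i, ζ⟫ ^ 2) := by
  classical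
  rw [inner_apply_self_eq_sum_eigen hA b hb ζ,
    ← Finset.sum_filter_add_sum_filter_not Finset.univ (fun i => 0 < a i), Finset.mul_sum,
    Finset.mul_sum, sub_eq_add_neg, ← Finset.sum_neg_distrib]
  refine add_le_add (Finset.sum_le_sum fun i _ => ?_) (Finset.sum_le_sum fun i hi => ?_)
  · exact mul_le_mul_of_nonneg_right (hα i) (sq_nonneg _)
  · rw [Finset.mem_filter] at hi
    have := hμ i hi.2
    rw [← neg_mul]
    exact mul_le_mul_of_nonneg_right (by linarith) (sq_nonneg _)

/-- `Σ_i ⟪b i, ζ⟫²` splits as the positive-index part plus the rest, and equals `|ζ|²`. [folklore] -/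
theorem sum_sq_inner_filter_add (b : OrthonormalBasis ι ℝ (EuclideanSpace ℝ (Fin 3)))
    (p : ι → Prop) [DecidablePred p] (ζ : EuclideanSpace ℝ (Fin 3)) :
    (∑ i ∈ Finset.univ.filter p, ⟪b i, ζ⟫ ^ 2) +
      (∑ i ∈ Finset.univ.filter (fun i => ¬ p i), ⟪b i, ζ⟫ ^ 2) = ‖ζ‖ ^ 2 := by
  rw [Finset.sum_filter_add_sum_filter_not, b.sum_sq_inner_right]

/-- A partial sum of squared coordinates is at most `|ζ|²`. [folklore] -/
theorem sum_sq_inner_filter_le (b : OrthonormalBasis ι ℝ (EuclideanSpace ℝ (Fin 3)))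
    (s : Finset ι) (ζ : EuclideanSpace ℝ (Fin 3)) :
    ∑ i ∈ s, ⟪b i, ζ⟫ ^ 2 ≤ ‖ζ‖ ^ 2 := by
  classical
  rw [← b.sum_sq_inner_right ζ]
  exact Finset.sum_le_univ_sum_of_nonneg fun i => sq_nonneg _

end Eigen

/-! ### The second-order expansion of `ℋ` at a non-vortical node -/

/-- **Second-order expansion of the Bernoulli function at a non-vortical stagnation point**:
`Hess ℋ(z) = (2γ−1) DV(z)`, quantitatively.  Let `(U, P)` be a `C²` self-similar Euler profile, `z` a
stagnation point of `V = γ(y−c) + U` with `curl U(z) = 0`.  For every `ν > 0` there is `δ > 0` with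
`ℋ(z + ζ) ≥ ℋ(z) + ½(2γ−1)⟪DV(z)ζ, ζ⟫ − ν|ζ|²` whenever `|ζ| ≤ δ`.  (Along `s ↦ z + sζ`:
`d/ds ℋ = (2γ−1)⟪V, ζ⟫ + ⟪V, DUζ⟫ − ⟪DU V, ζ⟫` (CIV (3.29)); `V(z+sζ) = s DV(z)ζ + o(s|ζ|)`; the
commutator is `o(s|ζ|²)` since `DU(z)` is symmetric (`curl U(z) = 0`) and `DU` is continuous.)
[cite: ConstantinIgnatovaVicol2026Putative, §3.4.3 eq. (3.29)–(3.31) (second variation at a node; not in print)] -/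
theorem selfSimilarBernoulli_expansion_of_curl_eq_zero (h : IsSelfSimilarEulerProfile γ c U P)
    {z : EuclideanSpace ℝ (Fin 3)} (hz : z ∈ selfSimilarNodalSet γ c U) (hΩz : curl U z = 0)
    {ν : ℝ} (hν : 0 < ν) :
    ∃ δ > 0, ∀ ζ : EuclideanSpace ℝ (Fin 3), ‖ζ‖ ≤ δ →
      selfSimilarBernoulli γ c U P z +
          (1 / 2 * ((2 * γ - 1) * ⟪fderiv ℝ (selfSimilarTransport γ c U) z ζ, ζ⟫) - ν * ‖ζ‖ ^ 2) ≤
        selfSimilarBernoulli γ c U P (z + ζ) := by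
  set V := selfSimilarTransport γ c U with hV
  set A := fderiv ℝ V z with hAdef
  set Hb := selfSimilarBernoulli γ c U P with hHb
  have hVz : V z = 0 := hz
  have hUd : Differentiable ℝ U := h.differentiable_velocity
  have hS := isSymmetric_fderiv_of_curl_eq_zero (hUd z) hΩz
  -- parameters: `ρ` for the linearisation, `κ` for the continuity of `DU`
  set ρ : ℝ := min 1 (ν / (2 * (|2 * γ - 1| + 1))) with hρ
  have hρpos : 0 < ρ := lt_min one_pos (by positivity)
  have hρ1 : ρ ≤ 1 := min_le_left _ _
  have hρν : |2 * γ - 1| * ρ ≤ ν / 2 := by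
    have h1 : ρ ≤ ν / (2 * (|2 * γ - 1| + 1)) := min_le_right _ _
    have h2 : |2 * γ - 1| * ρ ≤ |2 * γ - 1| * (ν / (2 * (|2 * γ - 1| + 1))) :=
      mul_le_mul_of_nonneg_left h1 (abs_nonneg _)
    have h3 : |2 * γ - 1| * (ν / (2 * (|2 * γ - 1| + 1))) ≤ ν / 2 := by
      rw [show |2 * γ - 1| * (ν / (2 * (|2 * γ - 1| + 1))) =
        ν / 2 * (|2 * γ - 1| / (|2 * γ - 1| + 1)) by field_simp]
      have : |2 * γ - 1| / (|2 * γ - 1| + 1) ≤ 1 := by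
        rw [div_le_one (by positivity)]; linarith
      calc ν / 2 * (|2 * γ - 1| / (|2 * γ - 1| + 1)) ≤ ν / 2 * 1 :=
            mul_le_mul_of_nonneg_left this (by linarith)
        _ = ν / 2 := mul_one _
    exact h2.trans h3
  set κ : ℝ := ν / (4 * (‖A‖ + 2)) with hκ
  have hκpos : 0 < κ := by positivity
  obtain ⟨δ₁, hδ₁, hlin⟩ := exists_ball_linearisation h z hρpos
  have hDUc : ContinuousAt (fun y => fderiv ℝ U y) z :=
    (h.contDiff_velocity.continuous_fderiv (by norm_num)).continuousAt
  obtain ⟨δ₂, hδ₂, hDU⟩ := Metric.continuousAt_iff.1 hDUc κ hκpos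
  set δ : ℝ := min δ₁ (δ₂ / 2) with hδ
  have hδpos : 0 < δ := lt_min hδ₁ (by linarith)
  refine ⟨δ, hδpos, fun ζ hζ => ?_⟩
  -- bounds along the segment
  have hseg : ∀ s ∈ Icc (0 : ℝ) 1, ‖s • ζ‖ ≤ δ := by
    intro s hs
    rw [norm_smul, Real.norm_eq_abs, abs_of_nonneg hs.1]
    calc s * ‖ζ‖ ≤ 1 * ‖ζ‖ := mul_le_mul_of_nonneg_right hs.2 (norm_nonneg _)
      _ ≤ δ := by rw [one_mul]; exact hζ
  have hE : ∀ s ∈ Icc (0 : ℝ) 1, ‖V (z + s • ζ) - A (s • ζ)‖ ≤ ρ * (s * ‖ζ‖) := by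
    intro s hs
    have hmem : z + s • ζ ∈ closedBall z δ₁ := by
      rw [mem_closedBall, dist_eq_norm, add_sub_cancel_left]
      exact (hseg s hs).trans (min_le_left _ _)
    have := hlin (z + s • ζ) hmem z (mem_closedBall_self hδ₁.le)
    rw [← hV, ← hAdef, hVz, sub_zero, add_sub_cancel_left] at this
    rw [norm_smul, Real.norm_eq_abs, abs_of_nonneg hs.1] at this
    exact this
  have hVn : ∀ s ∈ Icc (0 : ℝ) 1, ‖V (z + s • ζ)‖ ≤ (‖A‖ + ρ) * (s * ‖ζ‖) := by
    intro s hs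
    have h1 := hE s hs
    have h2 : ‖A (s • ζ)‖ ≤ ‖A‖ * (s * ‖ζ‖) := by
      have := A.le_opNorm (s • ζ)
      rwa [norm_smul, Real.norm_eq_abs, abs_of_nonneg hs.1] at this
    calc ‖V (z + s • ζ)‖ = ‖A (s • ζ) + (V (z + s • ζ) - A (s • ζ))‖ := by rw [add_sub_cancel]
      _ ≤ ‖A (s • ζ)‖ + ‖V (z + s • ζ) - A (s • ζ)‖ := norm_add_le _ _
      _ ≤ ‖A‖ * (s * ‖ζ‖) + ρ * (s * ‖ζ‖) := add_le_add h2 h1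
      _ = (‖A‖ + ρ) * (s * ‖ζ‖) := by ring
  have hDUs : ∀ s ∈ Icc (0 : ℝ) 1, ‖fderiv ℝ U (z + s • ζ) - fderiv ℝ U z‖ ≤ κ := by
    intro s hs
    have hd : dist (z + s • ζ) z < δ₂ := by
      rw [dist_eq_norm, add_sub_cancel_left]
      exact lt_of_le_of_lt ((hseg s hs).trans (min_le_right _ _)) (by linarith)
    have := hDU hd
    rw [dist_eq_norm] at this
    exact this.le
  -- the function along the segment and its derivative
  set g : ℝ → ℝ := fun s => Hb (z + s • ζ) with hg
  set q : ℝ := (2 * γ - 1) * ⟪A ζ, ζ⟫ - 2 * ν * ‖ζ‖ ^ 2 with hq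
  have hHd : Differentiable ℝ Hb := h.contDiff_selfSimilarBernoulli.differentiable one_ne_zero
  have hg' : ∀ s, HasDerivAt g (fderiv ℝ Hb (z + s • ζ) ζ) s := by
    intro s
    have hpath : HasDerivAt (fun s : ℝ => z + s • ζ) ζ s := by
      have := ((hasDerivAt_id s).smul_const ζ).const_add z
      simpa using this
    exact (hHd (z + s • ζ)).hasFDerivAt.comp_hasDerivAt s hpath
  -- lower bound for the derivative on `(0, 1)`
  have hlow : ∀ s ∈ Ioo (0 : ℝ) 1, s * q ≤ fderiv ℝ Hb (z + s • ζ) ζ := by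
    intro s hs
    have hs' : s ∈ Icc (0 : ℝ) 1 := ⟨hs.1.le, hs.2.le⟩
    set y := z + s • ζ with hy
    rw [h.fderiv_selfSimilarBernoulli_apply y ζ]
    -- first term
    set Es := V y - A (s • ζ) with hEs
    have hEsn : ‖Es‖ ≤ ρ * (s * ‖ζ‖) := hE s hs'
    have hVy : V y = s • A ζ + Es := by rw [hEs, map_smul]; abel
    set T : ℝ := s * ‖ζ‖ * ‖ζ‖ with hT
    have hTnn : 0 ≤ T := mul_nonneg (mul_nonneg hs.1.le (norm_nonneg _)) (norm_nonneg _)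
    have h1 : (2 * γ - 1) * (s * ⟪A ζ, ζ⟫) - |2 * γ - 1| * ρ * T ≤ (2 * γ - 1) * ⟪V y, ζ⟫ := by
      rw [hVy, inner_add_left, inner_smul_left]
      simp only [conj_trivial]
      have hb : |⟪Es, ζ⟫| ≤ ρ * T := by
        rw [hT, show ρ * (s * ‖ζ‖ * ‖ζ‖) = ρ * (s * ‖ζ‖) * ‖ζ‖ by ring]
        exact (abs_real_inner_le_norm _ _).trans (mul_le_mul_of_nonneg_right hEsn (norm_nonneg _))
      have hprod : |(2 * γ - 1) * ⟪Es, ζ⟫| ≤ |2 * γ - 1| * (ρ * T) := by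
        rw [abs_mul]; exact mul_le_mul_of_nonneg_left hb (abs_nonneg _)
      have := neg_abs_le ((2 * γ - 1) * ⟪Es, ζ⟫)
      nlinarith [this, hprod]
    -- commutator term
    have h2 : -(2 * (‖A‖ + ρ) * κ * T) ≤ ⟪V y, fderiv ℝ U y ζ⟫ - ⟪fderiv ℝ U y (V y), ζ⟫ := by
      have hsymm : ⟪V y, fderiv ℝ U z ζ⟫ = ⟪fderiv ℝ U z (V y), ζ⟫ := by
        have := hS (V y) ζ
        simp only [ContinuousLinearMap.coe_coe] at this
        rw [this]
      have e : ⟪V y, fderiv ℝ U y ζ⟫ - ⟪fderiv ℝ U y (V y), ζ⟫ =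
          ⟪V y, (fderiv ℝ U y - fderiv ℝ U z) ζ⟫ - ⟪(fderiv ℝ U y - fderiv ℝ U z) (V y), ζ⟫ := by
        simp only [FunLike.coe_sub, Pi.sub_apply, inner_sub_left, inner_sub_right]
        linarith [hsymm]
      rw [e]
      set R := fderiv ℝ U y - fderiv ℝ U z with hR
      have hRn : ‖R‖ ≤ κ := hDUs s hs'
      have hVyn : ‖V y‖ ≤ (‖A‖ + ρ) * (s * ‖ζ‖) := hVn s hs'
      have hsn : 0 ≤ s * ‖ζ‖ := mul_nonneg hs.1.le (norm_nonneg _)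
      have hb1 : |⟪V y, R ζ⟫| ≤ (‖A‖ + ρ) * κ * T := by
        calc |⟪V y, R ζ⟫| ≤ ‖V y‖ * ‖R ζ‖ := abs_real_inner_le_norm _ _
          _ ≤ ((‖A‖ + ρ) * (s * ‖ζ‖)) * (κ * ‖ζ‖) :=
              mul_le_mul hVyn ((R.le_opNorm ζ).trans (mul_le_mul_of_nonneg_right hRn (norm_nonneg _)))
                (norm_nonneg _) (by positivity)
          _ = (‖A‖ + ρ) * κ * T := by rw [hT]; ring
      have hb2 : |⟪R (V y), ζ⟫| ≤ (‖A‖ + ρ) * κ * T := by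
        calc |⟪R (V y), ζ⟫| ≤ ‖R (V y)‖ * ‖ζ‖ := abs_real_inner_le_norm _ _
          _ ≤ (κ * ((‖A‖ + ρ) * (s * ‖ζ‖))) * ‖ζ‖ :=
              mul_le_mul_of_nonneg_right ((R.le_opNorm _).trans
                (mul_le_mul hRn hVyn (norm_nonneg _) hκpos.le)) (norm_nonneg _)
          _ = (‖A‖ + ρ) * κ * T := by rw [hT]; ring
      have e1 := (abs_le.1 hb1).1
      have e2 := (abs_le.1 hb2).2
      linarith
    -- assemble: `ν`-budget
    have hbudget : |2 * γ - 1| * ρ + 2 * (‖A‖ + ρ) * κ ≤ 2 * ν := by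
      have hA0 : 0 ≤ ‖A‖ := norm_nonneg _
      have h3 : 2 * (‖A‖ + ρ) * κ ≤ ν := by
        rw [hκ, show 2 * (‖A‖ + ρ) * (ν / (4 * (‖A‖ + 2))) = ν * ((‖A‖ + ρ) / (2 * (‖A‖ + 2))) by
          field_simp; ring]
        have : (‖A‖ + ρ) / (2 * (‖A‖ + 2)) ≤ 1 := by
          rw [div_le_one (by positivity)]; linarith
        calc ν * ((‖A‖ + ρ) / (2 * (‖A‖ + 2))) ≤ ν * 1 := mul_le_mul_of_nonneg_left this hν.le
          _ = ν := mul_one _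
      linarith
    have hTb : (|2 * γ - 1| * ρ + 2 * (‖A‖ + ρ) * κ) * T ≤ 2 * ν * T :=
      mul_le_mul_of_nonneg_right hbudget hTnn
    have e3 : s * q = (2 * γ - 1) * (s * ⟪A ζ, ζ⟫) - 2 * ν * T := by rw [hq, hT]; ring
    rw [e3]
    have e4 : (|2 * γ - 1| * ρ + 2 * (‖A‖ + ρ) * κ) * T =
        |2 * γ - 1| * ρ * T + 2 * (‖A‖ + ρ) * κ * T := by ring
    linarith [h1, h2, hTb, e4]
  -- integrate: `φ s = g s - s²/2 · q` is nondecreasing on `[0, 1]`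
  set φ : ℝ → ℝ := fun s => g s - s ^ 2 / 2 * q with hφ
  have hφ' : ∀ s, HasDerivAt φ (fderiv ℝ Hb (z + s • ζ) ζ - s * q) s := by
    intro s
    have h1 : HasDerivAt (fun s : ℝ => s ^ 2 / 2 * q) (s * q) s := by
      have := ((hasDerivAt_pow 2 s).div_const 2).mul_const q
      refine this.congr_deriv ?_
      push_cast
      ring
    exact (hg' s).sub h1
  have hmono : MonotoneOn φ (Icc 0 1) := by
    refine monotoneOn_of_hasDerivWithinAt_nonneg (convex_Icc 0 1)
      (fun s _ => (hφ' s).continuousAt.continuousWithinAt) (fun s _ => (hφ' s).hasDerivWithinAt) ?_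
    intro s hs
    rw [interior_Icc] at hs
    linarith [hlow s hs]
  have h01 := hmono (left_mem_Icc.2 zero_le_one) (right_mem_Icc.2 zero_le_one) zero_le_one
  simp only [hφ, hg, zero_smul, add_zero, one_smul, one_pow] at h01
  simp only [hq] at h01
  norm_num at h01
  show Hb z + (1 / 2 * ((2 * γ - 1) * ⟪A ζ, ζ⟫) - ν * ‖ζ‖ ^ 2) ≤ Hb (z + ζ)
  linarith [h01]

/-! ### First exit time of a continuous curve from a ball -/

/-- **First exit time.**  A continuous curve `Y` with `|Y(0) − z| < r` and `|Y(t₀) − z| > r` for some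
`t₀ ≥ 0` has a first exit time `t₁ ∈ (0, t₀]`: `|Y(t₁) − z| = r` and `|Y(t) − z| ≤ r` on `[0, t₁]`
(indeed `< r` on `[0, t₁)`). [folklore] -/
theorem exists_firstExit {Y : ℝ → EuclideanSpace ℝ (Fin 3)} (hYc : Continuous Y)
    {z : EuclideanSpace ℝ (Fin 3)} {r : ℝ} (h0 : ‖Y 0 - z‖ < r) {t₀ : ℝ} (ht₀ : 0 ≤ t₀)
    (hout : r < ‖Y t₀ - z‖) :
    ∃ t₁, 0 < t₁ ∧ t₁ ≤ t₀ ∧ ‖Y t₁ - z‖ = r ∧ (∀ t ∈ Icc 0 t₁, ‖Y t - z‖ ≤ r) ∧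
      ∀ t ∈ Ico 0 t₁, ‖Y t - z‖ < r := by
  have hdc : Continuous fun t => ‖Y t - z‖ := (hYc.sub continuous_const).norm
  set S : Set ℝ := {t | 0 ≤ t ∧ r ≤ ‖Y t - z‖} with hS
  have hSc : IsClosed S := (isClosed_le continuous_const continuous_id).inter
    (isClosed_le continuous_const hdc)
  have hSne : S.Nonempty := ⟨t₀, ht₀, hout.le⟩
  have hSbdd : BddBelow S := ⟨0, fun t ht => ht.1⟩
  set t₁ := sInf S with ht₁
  have ht₁S : t₁ ∈ S := hSc.csInf_mem hSne hSbdd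
  have hbefore : ∀ t ∈ Ico 0 t₁, ‖Y t - z‖ < r := by
    intro t ht
    by_contra hge
    push Not at hge
    have : t₁ ≤ t := csInf_le hSbdd ⟨ht.1, hge⟩
    exact absurd ht.2 (not_lt.2 this)
  have ht₁pos : 0 < t₁ := by
    rcases ht₁S.1.eq_or_lt with h | h
    · exfalso
      have := ht₁S.2
      rw [← h] at this
      linarith
    · exact h
  have ht₁le : t₁ ≤ t₀ := csInf_le hSbdd ⟨ht₀, hout.le⟩
  -- `‖Y t₁ - z‖ ≤ r` by continuity from the left
  have hle : ‖Y t₁ - z‖ ≤ r := by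
    by_contra hgt
    push Not at hgt
    have hev : ∀ᶠ t in 𝓝 t₁, r < ‖Y t - z‖ := hdc.continuousAt.eventually (lt_mem_nhds hgt)
    obtain ⟨η, hη, hball⟩ := Metric.eventually_nhds_iff.1 hev
    set t := t₁ - min (η / 2) (t₁ / 2) with ht
    have hmin : 0 < min (η / 2) (t₁ / 2) := lt_min (by linarith) (by linarith)
    have htIco : t ∈ Ico 0 t₁ := by
      constructor
      · have : min (η / 2) (t₁ / 2) ≤ t₁ / 2 := min_le_right _ _
        rw [ht]; linarith
      · rw [ht]; linarith
    have hdist : dist t t₁ < η := by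
      rw [dist_eq_norm, Real.norm_eq_abs, ht, show t₁ - min (η / 2) (t₁ / 2) - t₁ =
        -(min (η / 2) (t₁ / 2)) by ring, abs_neg, abs_of_pos hmin]
      exact lt_of_le_of_lt (min_le_left _ _) (by linarith)
    have h1 := hball hdist
    have h2 := hbefore t htIco
    linarith
  refine ⟨t₁, ht₁pos, ht₁le, le_antisymm hle ht₁S.2, fun t ht => ?_, hbefore⟩
  rcases ht.2.eq_or_lt with h | h
  · rw [h]; exact hle
  · exact (hbefore t ⟨ht.1, h⟩).le

end Summit.NavierStokesRegularity.NavierStokesRegularity.Theorems.PowerGaugeEulerLiouville.NodalContinuum
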